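import Literature.NumberTheory.Irrationality.PAdicZetaValues.Hurwitz
import Mathlib.NumberTheory.Harmonic.Defs
import Mathlib.LinearAlgebra.LinearIndependent.Defs
import HarnessLib

/-!
# Linear independence of `1, ζ_p(2, p^{−r}), …, ζ_p(m+1, p^{−r})` (Bel 2010; Kawashima–Poëls 2025): named facts

Topic `Literature/NumberTheory/Irrationality/PAdicZetaValues`. Typed, cited statements (no proofs), read on the page from

* M. Kawashima, A. Poëls, *On the linear independence of `p`-adic polygamma values*, Mathematika 71 (2025) =
  arXiv:2410.06789 [KawashimaPoels2025] (held: `paper:arxiv-2410.06789`), §1 (p. 3), with `ζ_p(s, x)` their Definition 2.3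
  = Cohen's `p`-adic Hurwitz zeta function = `padicHurwitzZeta` of `Hurwitz.lean` ("We follow [C] for the definition …
  `ζ_p(s, x) = (1/(s−1)) ∫_{ℤ_p} ⟨x + t⟩^{1−s} dt = (⟨x⟩^{1−s}/(s−1)) Σ_{k≥0} binom(1−s, k) B_k x^{−k}`", §2.1, with the same
  `ω` at `p = 2`: "either `x` or `−x` is congruent to `1` modulo `4 = q_p`, and we set `ω(x) = ±1`, so that `x` is
  congruent to `ω(x)` modulo `4`"):

  "**Theorem 1.1 (Bel, 2010).** Let `m ≥ 1` be an integer and `p` be a prime number such that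
  `log p ≥ (1 + log 2)(m+1)²`. Then, the `m+1` elements of `ℚ_p`: `1, ζ_p(2, p^{−1}), …, ζ_p(m+1, p^{−1})` are linearly
  independent over `ℚ`." ("The following linear independence criterion is a consequence of the proof of [B1]" =
  P. Bel, Ann. Sc. Norm. Super. Pisa (5) 9 (2010) 189–227.)

  "Define the function `g : ℤ_{≥1} → ℝ⁺` by `g(M) = 0` for `M = 1, 2`, and `g(M) = (M+1) log(2(M+1)^{M+1}/M^M)` if `M > 2`.
  **Theorem 1.2.** Let `p` be a prime number and `m, r` be positive integers. Assume that
  `(r + 1/(p−1)) log p > g(m) + m + m(1 + ½ + ⋯ + 1/m)`. Then the `m+1` elements of `ℚ_p`: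
  `1, ζ_p(2, p^{−r}), …, ζ_p(m+1, p^{−r})` are linearly independent over `ℚ`." ("for `r = 1`, we improve Theorem 1.1 by
  replacing the condition `log p ≫ m²` with the condition `log p ≫ m log m`"; for `p = 2` the hypothesis forces `r ≥ 2`,
  so `|p^{−r}|_p ≥ q_p` throughout.)

  "**Theorem 1.3.** Let `p ≥ 3` be a prime number and `a, b, m, δ` be positive integers with `δ = a − 3(m+1)b > 0`. Assume
  that `(δ − (3m+2)/(p−1)) log p > g(2m+1) + (2m+1)(1 + ½ + ⋯ + 1/m)`. Then the `2m+1` elements of `ℚ_p`: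
  `1, ζ_p(2, p^{−a}), …, ζ_p(m+1, p^{−a}), ζ_p(2, p^{−a} + p^{−b}), …, ζ_p(m+1, p^{−a} + p^{−b})` are linearly independent
  over `ℚ`."

NOT typed: the main **Theorem 1.4** and **Theorem 1.6** (values of Diamond's `p`-adic polygamma functions `G_p^{(s)}` at
rational points with shifts `α`; needs Diamond's log-gamma `G_p` — gap recorded).

Rendering: the tuple `(1, ζ_p(2,x), …, ζ_p(m+1,x))` as the function `Fin (m+1) → ℚ_[p]`, `0 ↦ 1`, `i ↦ ζ_p(i+1, x)`
(`1 ≤ i ≤ m`); `1 + ½ + ⋯ + 1/m = harmonic m`; `g = kpG`.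

Cell zeta5-irr (HONEST FRAMING): RECORD entries; nothing about `ζ(5) ∈ ℝ`.
-/

noncomputable section

namespace Literature.NumberTheory.Irrationality.PAdicZetaValues

/-- `g(M) = 0` for `M = 1, 2`, and `g(M) = (M+1) log(2(M+1)^{M+1}/M^M)` for `M > 2` (`g(m) ∼ m log m`).
[cite: KawashimaPoels2025, §1 (1.2) (definition of `g`)] -/
def kpG (M : ℕ) : ℝ :=
  if M ≤ 2 then 0 else (M + 1) * Real.log (2 * ((M : ℝ) + 1) ^ (M + 1) / (M : ℝ) ^ M)

/-- The tuple `(1, ζ_p(2, x), ζ_p(3, x), …, ζ_p(m+1, x)) ∈ ℚ_p^{m+1}`. [cite: KawashimaPoels2025, Thm 1.2 (display)] -/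
def hurwitzTuple (p : ℕ) [Fact p.Prime] (m : ℕ) (x : ℚ_[p]) : Fin (m + 1) → ℚ_[p] :=
  fun i => if (i : ℕ) = 0 then 1 else padicHurwitzZeta p ((i : ℕ) + 1) x

/-- **Kawashima–Poëls 2025, Theorem 1.1 (Bel 2010)** (named fact, statement only): "Let `m ≥ 1` be an integer and `p` be
a prime number such that `log p ≥ (1 + log 2)(m+1)²`. Then, the `m+1` elements of `ℚ_p`:
`1, ζ_p(2, p^{−1}), …, ζ_p(m+1, p^{−1})` are linearly independent over `ℚ`." (For such `p`, `p ≥ 3`, so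
`|p^{−1}|_p = p = q_p`.) [cite: KawashimaPoels2025, Thm 1.1 (§1; after P. Bel 2010)] -/
def kawashimaPoels2025_theorem11 : Prop :=
  ∀ (p : ℕ) [Fact p.Prime] (m : ℕ), 1 ≤ m →
    (1 + Real.log 2) * ((m : ℝ) + 1) ^ 2 ≤ Real.log p →
      LinearIndependent ℚ (hurwitzTuple p m ((p : ℚ_[p])⁻¹))

/-- **Kawashima–Poëls 2025, Theorem 1.2** (named fact, statement only): "Let `p` be a prime number and `m, r` be positive
integers. Assume that `(r + 1/(p−1)) log p > g(m) + m + m(1 + ½ + ⋯ + 1/m)`. Then the `m+1` elements of `ℚ_p`: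
`1, ζ_p(2, p^{−r}), …, ζ_p(m+1, p^{−r})` are linearly independent over `ℚ`." [cite: KawashimaPoels2025, Thm 1.2 (§1)] -/
def kawashimaPoels2025_theorem12 : Prop :=
  ∀ (p : ℕ) [Fact p.Prime] (m r : ℕ), 1 ≤ m → 1 ≤ r →
    kpG m + m + m * (harmonic m : ℝ) < ((r : ℝ) + 1 / ((p : ℝ) - 1)) * Real.log p →
      LinearIndependent ℚ (hurwitzTuple p m ((p : ℚ_[p]) ^ (-(r : ℤ))))

/-- **Kawashima–Poëls 2025, Theorem 1.3** (named fact, statement only): "Let `p ≥ 3` be a prime number and `a, b, m, δ`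
be positive integers with `δ = a − 3(m+1)b > 0`. Assume that `(δ − (3m+2)/(p−1)) log p > g(2m+1) + (2m+1)(1 + ½ + ⋯ + 1/m)`.
Then the `2m+1` elements of `ℚ_p`: `1, ζ_p(2, p^{−a}), …, ζ_p(m+1, p^{−a}), ζ_p(2, p^{−a} + p^{−b}), …,
ζ_p(m+1, p^{−a} + p^{−b})` are linearly independent over `ℚ`" — rendered on `Fin (2m+1)`: `0 ↦ 1`, `i ↦ ζ_p(i+1, p^{−a})`
for `1 ≤ i ≤ m`, `i ↦ ζ_p(i − m + 1, p^{−a} + p^{−b})` for `m+1 ≤ i ≤ 2m`. [cite: KawashimaPoels2025, Thm 1.3 (§1)] -/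
def kawashimaPoels2025_theorem13 : Prop :=
  ∀ (p : ℕ) [Fact p.Prime] (a b m : ℕ), 3 ≤ p → 1 ≤ a → 1 ≤ b → 1 ≤ m → 3 * (m + 1) * b < a →
    kpG (2 * m + 1) + (2 * m + 1) * (harmonic m : ℝ) <
        (((a : ℝ) - 3 * (m + 1) * b) - (3 * m + 2) / ((p : ℝ) - 1)) * Real.log p →
      LinearIndependent ℚ (fun i : Fin (2 * m + 1) =>
        if (i : ℕ) = 0 then (1 : ℚ_[p])
        else if (i : ℕ) ≤ m then padicHurwitzZeta p ((i : ℕ) + 1) ((p : ℚ_[p]) ^ (-(a : ℤ)))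
        else padicHurwitzZeta p ((i : ℕ) - m + 1) ((p : ℚ_[p]) ^ (-(a : ℤ)) + (p : ℚ_[p]) ^ (-(b : ℤ))))

end Literature.NumberTheory.Irrationality.PAdicZetaValues
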